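import Summits.KontsevichZagierPeriods.KontsevichZagierPeriods.Theses.IsogenyCertificates
import Summits.KontsevichZagierPeriods.KontsevichZagierPeriods.Theorems.IsogenyCertificatesXMapPeriodTransferCellImage
import Summits.KontsevichZagierPeriods.KontsevichZagierPeriods.Theorems.IsogenyCertificatesXMapKernelStubSectorRepsExist
import Summits.KontsevichZagierPeriods.KontsevichZagierPeriods.Theorems.EllipticMomentKernel.Negative.Roots
import Summits.KontsevichZagierPeriods.KontsevichZagierPeriods.Theorems.ReducedPeriodRing.Negative.Certificates
import Literature.NumberTheory.Transcendental.KZSemiCanonicalReductionProofs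

/-!
# `XMapKernel` (stmt-KontsevichZagierPeriods-10663), line `derived-datum-quasi-periods` — engine, basic API

Basic API for the quasi-period ENGINE of the line `derived-datum-quasi-periods` of the crux
`IsogenyCertificates.XMapKernel` (lead prover's stub `stub_quasiTransferEngine`):

* the EGG of a three-real-root integral cubic `P = x³ + Ax + B` (`4A³ + 27B² < 0`): the set
  `{P > 0} ∖ (unbounded component)` is the open interval `(e₃, e₂)` between the two smallest roots
  (`egg_geometry`), with closure `[e₃, e₂]`;
* the egg representations `[egg, (a₀ + a₁x)/√P]` (`a₀, a₁ ∈ ℚ`) EXIST as honest `KZ.IntegralRep 1`'s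
  (`exists_eggRep`), and more generally `[egg, w(x)/√P]` for a `ℚ`-semialgebraic weight `w` bounded on
  the egg (`exists_weightedEggRep`);
* merging `m` copies of `[D, (a₀ + a₁x)/√P]` by rule (1b) (`merge_eggFamily`), and integer division in
  `KZ.relations` (`mem_relations_of_nsmul_mem_relations`, from the tree's unique divisibility of the
  formal period ring);
* the real x-map `f/g` read in the coordinate `x 0`: `ℚ`-semialgebraic where `g ≠ 0`, continuous, bounded
  on compact intervals (`isSemialgebraicFunOn_quot`, `continuousOn_quot`, `exists_bound_quot`);
* the cells of the egg of a datum: finitely many, at least one (`exists_eggCells`).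

No definitions are introduced; every set and function is written out.

References: M. Kontsevich, D. Zagier, *Periods* (2001), §§1.1–1.2; J. H. Silverman, *The Arithmetic of
Elliptic Curves* (2009), III.4–III.6 (x-rational isogenies), N. D. Elkies, *Elliptic and modular curves
over finite fields and related computational issues* (1998), §3 (the shape of the x-map).
-/

noncomputable section

open Set Filter MeasureTheory Polynomial Topology
open scoped BigOperators
open Literature.NumberTheory.Transcendental
open Literature.ModelTheory.ExponentialFields (IsSemialgebraic)
open Summit.KontsevichZagierPeriods.IsogenyCertificates.XMapPeriodTransferCells
open Summit.KontsevichZagierPeriods.HermiteRigidity.EllipticMomentKernelNegative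
  (cubic disc exists_roots cubic_sign_of_roots mem_Ioo_or_gt_of_cubic_pos cubic_pos_of_gt)

namespace Summit.KontsevichZagierPeriods.IsogenyCertificates.XMapKernelStubs.QuasiEngine

/-! ### The egg of a three-real-root cubic -/

/-- The Weierstrass cubic `4x³ − q₂x − q₃` with `q₂ = −4A`, `q₃ = −4B` is `4·(x³ + Ax + B)`. [folklore] -/
theorem cubic_neg_four (A B : ℤ) (x : ℝ) :
    cubic (-4 * (A : ℚ)) (-4 * (B : ℚ)) x = 4 * (x ^ 3 + (A : ℝ) * x + (B : ℝ)) := by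
  simp only [cubic, Rat.cast_mul, Rat.cast_neg, Rat.cast_ofNat, Rat.cast_intCast]
  ring

/-- **Egg geometry.** For `4A³ + 27B² < 0` the cubic `x³ + Ax + B` has three real roots
`e₃ < e₂ < e₁`, factors accordingly, and `{P > 0} ∖ (unbounded component) = (e₃, e₂)`. [folklore] -/
theorem egg_geometry (A B : ℤ) (hΔ : 4 * A ^ 3 + 27 * B ^ 2 < 0) :
    ∃ e₃ e₂ e₁ : ℝ, e₃ < e₂ ∧ e₂ < e₁ ∧
      (∀ x : ℝ, x ^ 3 + (A : ℝ) * x + (B : ℝ) = (x - e₃) * (x - e₂) * (x - e₁)) ∧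
      {y : ℝ | 0 < y ^ 3 + (A : ℝ) * y + (B : ℝ)} \
          connectedComponentIn {y : ℝ | 0 < y ^ 3 + (A : ℝ) * y + (B : ℝ)} (1 + |(A : ℝ)| + |(B : ℝ)|) =
        Ioo e₃ e₂ := by
  have hdisc : 0 < disc (-4 * (A : ℚ)) (-4 * (B : ℚ)) := by
    have h : ((4 * A ^ 3 + 27 * B ^ 2 : ℤ) : ℝ) < 0 := by exact_mod_cast hΔ
    push_cast at h
    simp only [disc, Rat.cast_mul, Rat.cast_neg, Rat.cast_ofNat, Rat.cast_intCast]
    nlinarith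
  obtain ⟨e₃, e₂, e₁, h3, h2a, h2b, h1, hf⟩ := exists_roots hdisc
  have h32 : e₃ < e₂ := by linarith
  have h21 : e₂ < e₁ := by linarith
  have hfac : ∀ x : ℝ, x ^ 3 + (A : ℝ) * x + (B : ℝ) = (x - e₃) * (x - e₂) * (x - e₁) := by
    intro x
    have h := hf x
    rw [cubic_neg_four] at h
    linarith
  refine ⟨e₃, e₂, e₁, h32, h21, hfac, ?_⟩
  obtain ⟨hpos, -⟩ := cubic_sign_of_roots h32 h21 hf
  have he₃ : e₃ ^ 3 + (A : ℝ) * e₃ + (B : ℝ) = 0 := by rw [hfac]; ring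
  have he₂ : e₂ ^ 3 + (A : ℝ) * e₂ + (B : ℝ) = 0 := by rw [hfac]; ring
  have hIoo : Ioo e₃ e₂ ⊆ {y : ℝ | 0 < y ^ 3 + (A : ℝ) * y + (B : ℝ)} := by
    intro y hy
    have h := hpos y hy
    rw [cubic_neg_four] at h
    simp only [mem_setOf_eq]
    linarith
  exact ((stub_cubicComponents A B hΔ.ne _ rfl e₃ he₃).2 e₂ he₂ h32 hIoo).symm

/-- On the egg the cubic is positive, and it vanishes at the two ends. [folklore] -/
theorem egg_sign {A B : ℤ} {e₃ e₂ e₁ : ℝ} (_h32 : e₃ < e₂) (_h21 : e₂ < e₁)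
    (hfac : ∀ x : ℝ, x ^ 3 + (A : ℝ) * x + (B : ℝ) = (x - e₃) * (x - e₂) * (x - e₁)) :
    (∀ x ∈ Ioo e₃ e₂, 0 < x ^ 3 + (A : ℝ) * x + (B : ℝ)) ∧
      e₃ ^ 3 + (A : ℝ) * e₃ + (B : ℝ) = 0 ∧ e₂ ^ 3 + (A : ℝ) * e₂ + (B : ℝ) = 0 := by
  refine ⟨fun x hx => ?_, by rw [hfac]; ring, by rw [hfac]; ring⟩
  rw [hfac, show (x - e₃) * (x - e₂) * (x - e₁) = (x - e₃) * (e₂ - x) * (e₁ - x) by ring]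
  have h1 : 0 < x - e₃ := by linarith [hx.1]
  have h2 : 0 < e₂ - x := by linarith [hx.2]
  have h3 : 0 < e₁ - x := by linarith [hx.2]
  positivity

/-! ### Integrability of `dx/√P` and the egg representations -/

/-- `dx/√P` is integrable on `{P > 0}` for a nonsingular integral cubic (from the sector
representation of the sibling line). [cite: KontsevichZagier2001, §1.1] -/
theorem integrableOn_inv_sqrt (A B : ℤ) (hΔ : 4 * A ^ 3 + 27 * B ^ 2 ≠ 0) :
    IntegrableOn (fun x : Fin 1 → ℝ => 1 / Real.sqrt (x 0 ^ 3 + (A : ℝ) * x 0 + (B : ℝ)))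
      {x : Fin 1 → ℝ | 0 < x 0 ^ 3 + (A : ℝ) * x 0 + (B : ℝ)} := by
  obtain ⟨r, hd, hi⟩ := SectorRepsExist.stub_sectorRepsExist A B 1 hΔ
  have h := r.integrableOn
  rw [hd, hi] at h
  simpa using h

/-- The egg lies in `{P > 0}` (as subsets of `ℝ¹`). [folklore] -/
theorem hatEgg_subset_pos (A B : ℤ) :
    {x : Fin 1 → ℝ | x 0 ∈ {y : ℝ | 0 < y ^ 3 + (A : ℝ) * y + (B : ℝ)} \
      connectedComponentIn {y : ℝ | 0 < y ^ 3 + (A : ℝ) * y + (B : ℝ)} (1 + |(A : ℝ)| + |(B : ℝ)|)} ⊆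
      {x : Fin 1 → ℝ | 0 < x 0 ^ 3 + (A : ℝ) * x 0 + (B : ℝ)} := fun _ hx => hx.1

/-- **Weighted egg representations exist.** For a three-real-root integral cubic and a weight `w`
which is a `ℚ`-semialgebraic function on the egg, continuous on the egg and bounded there, the
representation `[egg, w/√P]` is an honest `KZ.IntegralRep 1` (bounded measurable times the integrable
`1/√P`). [cite: KontsevichZagier2001, §1.1] -/
theorem exists_weightedEggRep (A B : ℤ) (hΔ : 4 * A ^ 3 + 27 * B ^ 2 < 0) (w : (Fin 1 → ℝ) → ℝ)
    (hw : IsSemialgebraicFunOn ℚ {x : Fin 1 → ℝ | x 0 ∈ {y : ℝ | 0 < y ^ 3 + (A : ℝ) * y + (B : ℝ)} \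
      connectedComponentIn {y : ℝ | 0 < y ^ 3 + (A : ℝ) * y + (B : ℝ)} (1 + |(A : ℝ)| + |(B : ℝ)|)} w)
    (hwc : ContinuousOn w {x : Fin 1 → ℝ | x 0 ∈ {y : ℝ | 0 < y ^ 3 + (A : ℝ) * y + (B : ℝ)} \
      connectedComponentIn {y : ℝ | 0 < y ^ 3 + (A : ℝ) * y + (B : ℝ)} (1 + |(A : ℝ)| + |(B : ℝ)|)})
    (M : ℝ) (hwb : ∀ x ∈ {x : Fin 1 → ℝ | x 0 ∈ {y : ℝ | 0 < y ^ 3 + (A : ℝ) * y + (B : ℝ)} \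
      connectedComponentIn {y : ℝ | 0 < y ^ 3 + (A : ℝ) * y + (B : ℝ)} (1 + |(A : ℝ)| + |(B : ℝ)|)},
      ‖w x‖ ≤ M) :
    ∃ r : KZ.IntegralRep 1,
      r.domain = {x : Fin 1 → ℝ | x 0 ∈ {y : ℝ | 0 < y ^ 3 + (A : ℝ) * y + (B : ℝ)} \
        connectedComponentIn {y : ℝ | 0 < y ^ 3 + (A : ℝ) * y + (B : ℝ)} (1 + |(A : ℝ)| + |(B : ℝ)|)} ∧
      r.integrand = fun x => w x / Real.sqrt (x 0 ^ 3 + (A : ℝ) * x 0 + (B : ℝ)) := by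
  set D : Set (Fin 1 → ℝ) := {x : Fin 1 → ℝ | x 0 ∈ {y : ℝ | 0 < y ^ 3 + (A : ℝ) * y + (B : ℝ)} \
    connectedComponentIn {y : ℝ | 0 < y ^ 3 + (A : ℝ) * y + (B : ℝ)} (1 + |(A : ℝ)| + |(B : ℝ)|)} with hD
  have hDsa : IsSemialgebraic ℚ D := isSemialgebraic_hat_egg A B
  have hDS : D ⊆ {x : Fin 1 → ℝ | 0 < x 0 ^ 3 + (A : ℝ) * x 0 + (B : ℝ)} := hatEgg_subset_pos A B
  have hmeas : MeasurableSet D := IsSemialgebraic.measurableSet_holds hDsa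
  have hsa : IsSemialgebraicFunOn ℚ D (fun x => w x / Real.sqrt (x 0 ^ 3 + (A : ℝ) * x 0 + (B : ℝ))) := by
    have h1 := (XMapPeriodTransferValue.isSemialgebraicFunOn_integrand A B 1).mono hDS hDsa
    refine (IsSemialgebraicFunOn.mul_holds hw h1).congr fun x _ => ?_
    simp only [Pi.mul_apply, Rat.cast_one]
    ring
  have hint1 : IntegrableOn (fun x : Fin 1 → ℝ => 1 / Real.sqrt (x 0 ^ 3 + (A : ℝ) * x 0 + (B : ℝ))) D :=
    (integrableOn_inv_sqrt A B hΔ.ne).mono_set hDS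
  have hint : IntegrableOn (fun x => w x / Real.sqrt (x 0 ^ 3 + (A : ℝ) * x 0 + (B : ℝ))) D := by
    have hws : AEStronglyMeasurable w (volume.restrict D) :=
      hwc.aestronglyMeasurable hmeas
    have h : Integrable (fun x => w x * (1 / Real.sqrt (x 0 ^ 3 + (A : ℝ) * x 0 + (B : ℝ))))
        (volume.restrict D) :=
      Integrable.bdd_mul (c := M) hint1 hws
        ((ae_restrict_iff' hmeas).mpr (Filter.Eventually.of_forall hwb))
    refine IntegrableOn.congr_fun h (fun x _ => ?_) hmeas
    ring
  exact ⟨⟨D, _, hDsa, hsa, hint⟩, rfl, rfl⟩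

/-- **The egg representations exist**: `[egg(A,B), (a₀ + a₁x)/√P]` is an honest `KZ.IntegralRep 1`
for every three-real-root integral cubic and all `a₀, a₁ ∈ ℚ` (the egg is bounded).
[cite: KontsevichZagier2001, §1.1] -/
theorem exists_eggRep : ∀ (A B : ℤ) (a₀ a₁ : ℚ), 4 * A ^ 3 + 27 * B ^ 2 < 0 → ∃ r : Literature.NumberTheory.Transcendental.KZ.IntegralRep 1, r.domain = {x | x 0 ∈ {y : ℝ | 0 < y ^ 3 + (A : ℝ) * y + (B : ℝ)} \ connectedComponentIn {y : ℝ | 0 < y ^ 3 + (A : ℝ) * y + (B : ℝ)} (1 + |(A : ℝ)| + |(B : ℝ)|)} ∧ r.integrand = fun x => ((a₀ : ℝ) + (a₁ : ℝ) * x 0) / Real.sqrt (x 0 ^ 3 + (A : ℝ) * x 0 + (B : ℝ)) := by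
  intro A B a₀ a₁ hΔ
  obtain ⟨e₃, e₂, e₁, _, _, _, hegg⟩ := egg_geometry A B hΔ
  have hDsa := isSemialgebraic_hat_egg A B
  -- the weight is a polynomial, hence semialgebraic and continuous; bounded on the bounded egg
  set p : MvPolynomial (Fin 1) ℚ := MvPolynomial.C a₀ + MvPolynomial.C a₁ * MvPolynomial.X 0 with hp
  have hpev : ∀ x : Fin 1 → ℝ, MvPolynomial.aeval x p = (a₀ : ℝ) + (a₁ : ℝ) * x 0 := fun x => by
    simp [hp]
  have hw : IsSemialgebraicFunOn ℚ _ (fun x : Fin 1 → ℝ => (a₀ : ℝ) + (a₁ : ℝ) * x 0) :=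
    (isSemialgebraicFunOn_aeval hDsa p).congr fun x _ => hpev x
  have hwc : ContinuousOn (fun x : Fin 1 → ℝ => (a₀ : ℝ) + (a₁ : ℝ) * x 0)
      {x : Fin 1 → ℝ | x 0 ∈ {y : ℝ | 0 < y ^ 3 + (A : ℝ) * y + (B : ℝ)} \
        connectedComponentIn {y : ℝ | 0 < y ^ 3 + (A : ℝ) * y + (B : ℝ)} (1 + |(A : ℝ)| + |(B : ℝ)|)} :=
    (by fun_prop : Continuous fun x : Fin 1 → ℝ => (a₀ : ℝ) + (a₁ : ℝ) * x 0).continuousOn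
  obtain ⟨r, hd, hi⟩ := exists_weightedEggRep A B hΔ _ hw hwc (|(a₀ : ℝ)| + |(a₁ : ℝ)| * (|e₃| + |e₂|))
    (fun x hx => by
      have hx' : x 0 ∈ Ioo e₃ e₂ := by rw [← hegg]; exact hx
      have hb : |x 0| ≤ |e₃| + |e₂| := by
        rcases le_or_gt 0 (x 0) with h | h
        · rw [abs_of_nonneg h]; linarith [hx'.2, le_abs_self e₂, abs_nonneg e₃]
        · rw [abs_of_neg h]; linarith [hx'.1, neg_abs_le e₃, abs_nonneg e₂]
      calc ‖(a₀ : ℝ) + (a₁ : ℝ) * x 0‖ ≤ |(a₀ : ℝ)| + |(a₁ : ℝ) * x 0| := abs_add_le _ _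
        _ = |(a₀ : ℝ)| + |(a₁ : ℝ)| * |x 0| := by rw [abs_mul]
        _ ≤ |(a₀ : ℝ)| + |(a₁ : ℝ)| * (|e₃| + |e₂|) := by gcongr)
  exact ⟨r, hd, hi⟩

/-! ### Merging copies, and integer division in `KZ.relations` -/

/-- Merging copies of the egg family `T a₀ a₁ = [D, (a₀ + a₁x)/√P]` by integrand additivity:
`m • [T a₀ a₁] − [T (m a₀) (m a₁)] ∈ KZ.relations`. [cite: KontsevichZagier2001, §1.2 rule (1)] -/
theorem merge_eggFamily {A B : ℤ} {D : Set (Fin 1 → ℝ)} (T : ℚ → ℚ → KZ.IntegralRep 1)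
    (hTd : ∀ a₀ a₁, (T a₀ a₁).domain = D)
    (hTi : ∀ a₀ a₁, (T a₀ a₁).integrand = fun x => ((a₀ : ℝ) + (a₁ : ℝ) * x 0) /
      Real.sqrt (x 0 ^ 3 + (A : ℝ) * x 0 + (B : ℝ))) (a₀ a₁ : ℚ) :
    ∀ m : ℕ, m • KZ.of (T a₀ a₁) - KZ.of (T (m * a₀) (m * a₁)) ∈ KZ.relations
  | 0 => by
      have h : KZ.of (T (((0 : ℕ) : ℚ) * a₀) (((0 : ℕ) : ℚ) * a₁)) ∈ KZ.relations :=
        KZ.of_mem_relations_of_eqOn_zero _ fun x _ => by simp [hTi]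
      simpa using KZ.relations.neg_mem h
  | m + 1 => by
      have ih := merge_eggFamily T hTd hTi a₀ a₁ m
      have hadd : KZ.of (T ((m + 1 : ℕ) * a₀) ((m + 1 : ℕ) * a₁)) - KZ.of (T (m * a₀) (m * a₁)) -
          KZ.of (T a₀ a₁) ∈ KZ.relations :=
        KZ.integrandAddRel_subset_relations ⟨1, T _ _, T _ _, T _ _, by rw [hTd, hTd], by rw [hTd, hTd],
          fun x _ => by simp only [hTi, Pi.add_apply]; push_cast; ring, rfl⟩
      have : (m + 1) • KZ.of (T a₀ a₁) - KZ.of (T ((m + 1 : ℕ) * a₀) ((m + 1 : ℕ) * a₁)) =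
          (m • KZ.of (T a₀ a₁) - KZ.of (T (m * a₀) (m * a₁))) -
            (KZ.of (T ((m + 1 : ℕ) * a₀) ((m + 1 : ℕ) * a₁)) - KZ.of (T (m * a₀) (m * a₁)) -
              KZ.of (T a₀ a₁)) := by
        rw [succ_nsmul]; abel
      rw [this]
      exact KZ.relations.sub_mem ih hadd

/-- **Integer division in `KZ.relations`**: `N • c ∈ relations → c ∈ relations` for `N ≥ 1`, from the
tree's unique divisibility of the formal period ring (`ReducedPeriodRingNegative.nsmul_bijective`).
[folklore] -/
theorem mem_relations_of_nsmul_mem_relations {c : KZ.FormalRep} {N : ℕ} (hN : 0 < N)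
    (h : N • c ∈ KZ.relations) : c ∈ KZ.relations := by
  rw [← KZ.toFormalPeriod_eq_zero_iff] at h ⊢
  rw [map_nsmul] at h
  exact (Summit.KontsevichZagierPeriods.KontsevichZagierPeriods.ReducedPeriodRingNegative.nsmul_bijective
    hN).1 (by simpa using h)

/-! ### The x-map read in `x 0`: semialgebraic, continuous, bounded on the closed egg -/

/-- A quotient `p/g` of one-variable rational polynomials, read in the coordinate `x 0` of `ℝ¹`, is a
`ℚ`-semialgebraic function on every `ℚ`-semialgebraic set on which `g ≠ 0`. [cite: BCR1998, §2.2] -/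
theorem isSemialgebraicFunOn_quot (p g : ℚ[X]) {D : Set (Fin 1 → ℝ)} (hD : IsSemialgebraic ℚ D)
    (hg : ∀ x ∈ D, aeval (x 0) g ≠ 0) :
    IsSemialgebraicFunOn ℚ D (fun x => aeval (x 0) p / aeval (x 0) g) := by
  have h := isSemialgebraicFunOn_aeval_div_aeval hD (aeval (MvPolynomial.X 0 : MvPolynomial (Fin 1) ℚ) p)
    (aeval (MvPolynomial.X 0 : MvPolynomial (Fin 1) ℚ) g)
    (fun x hx => by rw [aeval_aeval_X_zero]; exact hg x hx)
  exact h.congr fun x _ => by simp only [aeval_aeval_X_zero]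

/-- A quotient `p/g` is continuous on any set of reals where `g ≠ 0`. [folklore] -/
theorem continuousOn_quot (p g : ℚ[X]) {K : Set ℝ} (hg : ∀ y ∈ K, aeval y g ≠ 0) :
    ContinuousOn (fun y : ℝ => aeval y p / aeval y g) K := fun y hy =>
  ((cellMonotone_hasDerivAt p g (hg y hy)).continuousAt).continuousWithinAt

/-- A quotient `p/g` with `g ≠ 0` on a compact interval `[u, v]` is bounded there. [folklore] -/
theorem exists_bound_quot (p g : ℚ[X]) {u v : ℝ} (hg : ∀ y ∈ Icc u v, aeval y g ≠ 0) :
    ∃ M : ℝ, ∀ y ∈ Icc u v, |aeval y p / aeval y g| ≤ M := by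
  obtain ⟨M, hM⟩ := isCompact_Icc.exists_bound_of_continuousOn (continuousOn_quot p g hg)
  refine ⟨M, fun y hy => ?_⟩
  have h := hM y hy
  rwa [Real.norm_eq_abs] at h

/-! ### The cells of the egg -/

/-- **The cells of the egg**: for an x-rational datum with `W ≠ 0` on a three-real-root cubic, the
cells `connectedComponentIn L y` (`L = {P > 0, W ≠ 0}`) of points `y` of the egg form a finite
non-empty set. [cite: BasuPollackRoy2006, Thm. 5.22] -/
theorem exists_eggCells (A B : ℤ) (hΔ : 4 * A ^ 3 + 27 * B ^ 2 < 0) (f g : ℚ[X])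
    (hW : derivative f * g - f * derivative g ≠ 0) :
    ∃ 𝒞 : Finset (Set ℝ), (∀ K, K ∈ 𝒞 ↔ ∃ y ∈ {y : ℝ | 0 < y ^ 3 + (A : ℝ) * y + (B : ℝ) ∧
        aeval y (derivative f * g - f * derivative g) ≠ 0},
      y ∈ {y : ℝ | 0 < y ^ 3 + (A : ℝ) * y + (B : ℝ)} \
        connectedComponentIn {y : ℝ | 0 < y ^ 3 + (A : ℝ) * y + (B : ℝ)} (1 + |(A : ℝ)| + |(B : ℝ)|) ∧
      K = connectedComponentIn {y : ℝ | 0 < y ^ 3 + (A : ℝ) * y + (B : ℝ) ∧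
        aeval y (derivative f * g - f * derivative g) ≠ 0} y) ∧ 0 < 𝒞.card := by
  set L : Set ℝ := {y : ℝ | 0 < y ^ 3 + (A : ℝ) * y + (B : ℝ) ∧
    aeval y (derivative f * g - f * derivative g) ≠ 0} with hL
  set E : Set ℝ := {y : ℝ | 0 < y ^ 3 + (A : ℝ) * y + (B : ℝ)} \
    connectedComponentIn {y : ℝ | 0 < y ^ 3 + (A : ℝ) * y + (B : ℝ)} (1 + |(A : ℝ)| + |(B : ℝ)|) with hE
  have hLsa : IsSemialgebraic ℚ {x : Fin 1 → ℝ | x 0 ∈ L} := isSemialgebraic_hat_cellLocus A B f g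
  have hfin : {K : Set ℝ | ∃ y ∈ L, y ∈ E ∧ K = connectedComponentIn L y}.Finite :=
    (finite_setOf_connectedComponentIn hLsa).subset fun K ⟨y, hyL, _, hK⟩ => ⟨y, hyL, hK⟩
  refine ⟨hfin.toFinset, fun K => hfin.mem_toFinset, ?_⟩
  -- a point of the egg off the finite zero set of `W`
  obtain ⟨e₃, e₂, e₁, h32, h21, hfac, hegg⟩ := egg_geometry A B hΔ
  have hZfin : {y : ℝ | aeval y (derivative f * g - f * derivative g) = 0}.Finite := by
    refine ((derivative f * g - f * derivative g).aroots ℝ).toFinset.finite_toSet.subset fun y hy => ?_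
    exact Finset.mem_coe.mpr (Multiset.mem_toFinset.mpr (Polynomial.mem_aroots.mpr ⟨hW, hy⟩))
  obtain ⟨y, hyI, hyZ⟩ : ∃ y ∈ Ioo e₃ e₂, y ∉ {y : ℝ | aeval y (derivative f * g - f * derivative g) = 0} :=
    ((Ioo_infinite h32).sdiff hZfin).nonempty
  have hyP : 0 < y ^ 3 + (A : ℝ) * y + (B : ℝ) := (egg_sign h32 h21 hfac).1 y hyI
  have hyL : y ∈ L := ⟨hyP, hyZ⟩
  have hyE : y ∈ E := by rw [hE, hegg]; exact hyI
  refine Finset.card_pos.mpr ⟨connectedComponentIn L y, hfin.mem_toFinset.mpr ⟨y, hyL, hyE, rfl⟩⟩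

end Summit.KontsevichZagierPeriods.IsogenyCertificates.XMapKernelStubs.QuasiEngine

end
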